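import Summits.Ventures.PercRepro.RankLevelSetRuleQCellThreeRow
import Summits.Ventures.PercRepro.RankLevelSetRuleQSliceOne

/-!
# PercRepro — (R̂) HOLDS ON EVERY CELL `(q+3, q)`: RULE Q AND THE UP-HALL FORM FOR THE WHOLE CELL `k = 3`, EVERY `q ≥ 1`
(p4, gen 21; paper proofs/P4-CELL-THREE.md)

For `k = 3` and `u = q − m ≥ 2` the truncation in `m̂` is void: `m̂(q, m; a, 1) = C(q+1+a, a+1)`, `m̂(q, m; a, 2) = C(q+2+a, a+2)`,
so `R̂(q, 3, m) = (u+3)·S₁ + C(u+3, 2)·S₂` with the slice sums `S_j = Σ_{a ≤ m} C(m, a)/C(q+j+a, a+j)`, and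
`Φ(q+3, q) = 2(q+3)/(q+1)`. On the row `N = q + m + 1` (RankLevelSetRuleQCellThreeRow) `S₁ = (D + Q)/((q+1)C(N, m))`,
`S₂ = 2V/((q+1)(q+m+2)C(N, m))`, the identities `row_id_one` / `row_id_two` eliminate `Q` and `V`, and the inequality becomes
`A·C(N, m) + (u+3)·K·D ≥ 0` with `A = v³m + v²m² + 8v²m + 5vm² + 23vm + 16m² + 32m ≥ 0` (`u = v + 2`) and
`K = −v³ − 5v² + 2vm − 6v − 4m − 8`: for `K ≥ 0` it is immediate, for `K < 0` the geometric bound `row_D_le` turns it into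
`E·C(N, m) ≥ 0` with `E = 2v⁴m + 6v³m² + 4v²m³ + 30v³m + 60v²m² + 16vm³ + 158v²m + 178vm² + 12m³ + 346vm + 156m² + 264m`.
The slices `m = q` (RuleQCellEnds `rhatCell_self`) and `m = q − 1` (RuleQSliceOne `rhatCell_pred`) complete the cell.
* **`rhatCell_three`** — `RhatCell q 3` for every `q ≥ 1`;
* **`ruleQUp_three`** / **`hallUp_three`** — Rule Q pays `Φ(q+3, q)` to EVERY member, and the UP-Hall form holds, at the tight
  layer `#E = (q+3) + q` of every finite matroid, for every `q ≥ 1` (via RankLevelSetRuleQCell's transfer).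
Equality only at `m = 0`. Twin: lean-drafts/p4/g21/cell3/twin/ (identities exact, 0 violations, `q ≤ 150`). Axioms: standard.
-/

namespace PercRepro

open Finset

/-! ### §1 `Φ`, `m̂` and `R̂` on the cell `(q+3, q)` -/

/-- `Φ(q+3, q) = 2(q+3)/(q+1)`. -/
lemma phiK_three (q : ℕ) : phiK (q + 3) q = 2 * (q + 3 : ℚ) / (q + 1) := by
  rw [phiK_eq_sum_range q 3 (by omega), show (3 : ℕ) - 1 = 1 + 1 from rfl, Finset.sum_range_succ _ 1,
    Finset.sum_range_one]
  simp only [zero_add, add_zero, Nat.choose_one_right, Nat.reduceAdd]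
  have h1 : (q + 1).choose q = q + 1 := by rw [Nat.choose_symm_add, Nat.choose_one_right]
  have h2 : (q + 1 + 1).choose q = (q + 1 + 1).choose 2 := by
    rw [show q + 1 + 1 = q + 2 by ring, Nat.choose_symm_add]
  have h3 : ((q + 3).choose 2 : ℚ) * 2 = (q + 3) * (q + 2) := by
    have h := Nat.add_one_mul_choose_eq (q + 2) 1
    rw [Nat.choose_one_right, show q + 2 + 1 = q + 3 by ring, show (1 : ℕ) + 1 = 2 from rfl] at h
    have h' : (((q + 3) * (q + 2) : ℕ) : ℚ) = (((q + 3).choose 2 * 2 : ℕ) : ℚ) := by rw [h]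
    push_cast at h'
    linarith [h']
  have h4 : ((q + 1 + 1).choose 2 : ℚ) * 2 = (q + 2) * (q + 1) := by
    have h := Nat.add_one_mul_choose_eq (q + 1) 1
    rw [Nat.choose_one_right, show (1 : ℕ) + 1 = 2 from rfl] at h
    have h' : (((q + 1 + 1) * (q + 1) : ℕ) : ℚ) = (((q + 1 + 1).choose 2 * 2 : ℕ) : ℚ) := by rw [h]
    push_cast at h'
    linarith [h']
  rw [h1, h2]
  have hq : (0 : ℚ) < q + 1 := by positivity
  have hq2 : (0 : ℚ) < (q + 1 + 1).choose 2 := by exact_mod_cast Nat.choose_pos (by omega)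
  push_cast
  rw [div_add_div _ _ hq.ne' hq2.ne', div_eq_div_iff (by positivity) hq.ne']
  linear_combination (((q : ℚ) + 1) ^ 2 / 2) * h3 - (((q : ℚ) + 1) * ((q : ℚ) + 3) / 2) * h4

/-- On the cell `(q+3, q)` with `u = q − m ≥ 2` (`q = m + v + 2`): `m̂(q, m; a, 1) = C(q+1+a, a+1)`. -/
lemma mhat_three_one (m v a : ℕ) : mhat (m + v + 2) m a 1 = (m + v + 2 + 1 + a).choose (a + 1) := by
  rw [mhat_eq, show m + v + 2 - m = v + 2 by omega, show min 1 (v + 2) = 1 by omega]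
  simp only [Finset.sum_range_succ, Finset.sum_range_zero, Nat.choose_zero_right, Nat.choose_one_right,
    add_zero, zero_add, one_mul]
  rw [show m + v + 2 + 1 + a = m + v + 2 + a + 1 by ring, Nat.choose_succ_succ]

/-- On the cell `(q+3, q)` with `u = q − m ≥ 2` (`q = m + v + 2`): `m̂(q, m; a, 2) = C(q+2+a, a+2)`. -/
lemma mhat_three_two (m v a : ℕ) : mhat (m + v + 2) m a 2 = (m + v + 2 + 2 + a).choose (a + 2) := by
  rw [mhat_eq, show m + v + 2 - m = v + 2 by omega, show min 2 (v + 2) = 2 by omega]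
  simp only [Finset.sum_range_succ, Finset.sum_range_zero, Nat.choose_zero_right, Nat.choose_one_right,
    Nat.choose_self, add_zero, zero_add, one_mul]
  rw [show m + v + 2 + 2 + a = m + v + 2 + a + 1 + 1 by ring, Nat.choose_succ_succ, Nat.choose_succ_succ,
    Nat.choose_succ_succ]
  ring

/-- `R̂(q, 3, m) = (u+3)·S₁ + C(u+3, 2)·S₂` on the cell `(q+3, q)` with `q = m + v + 2`. -/
lemma rhat_three_eq (m v : ℕ) :
    rhat (m + v + 2) 3 m
      = ((v : ℚ) + 5) * ∑ a ∈ range (m + 1), (m.choose a : ℚ) / ((m + v + 2 + 1 + a).choose (a + 1) : ℚ)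
        + ((v : ℚ) + 5) * ((v : ℚ) + 4) / 2
          * ∑ a ∈ range (m + 1), (m.choose a : ℚ) / ((m + v + 2 + 2 + a).choose (a + 2) : ℚ) := by
  unfold rhat
  rw [sum_Ioo_nat, show (3 : ℕ) - (0 + 1) = 1 + 1 from rfl, Finset.sum_range_succ _ 1, Finset.sum_range_one]
  simp only [zero_add, add_zero, Nat.reduceAdd, mhat_three_one, mhat_three_two,
    show m + v + 2 + 3 - m = v + 5 by omega, Nat.choose_one_right]
  rw [Finset.mul_sum, Finset.mul_sum]
  have h5 : ((v + 5).choose 2 : ℚ) = (v + 5) * (v + 4) / 2 := by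
    have h := Nat.add_one_mul_choose_eq (v + 4) 1
    rw [Nat.choose_one_right, show v + 4 + 1 = v + 5 by ring, show (1 : ℕ) + 1 = 2 from rfl] at h
    have h' : (((v + 5) * (v + 4) : ℕ) : ℚ) = (((v + 5).choose 2 * 2 : ℕ) : ℚ) := by rw [h]
    push_cast at h'
    linarith [h']
  congr 1
  · refine Finset.sum_congr rfl (fun a _ => ?_)
    push_cast; ring
  · refine Finset.sum_congr rfl (fun a _ => ?_)
    push_cast
    rw [h5]; ring

/-! ### §2 The inequality for `u ≥ 2` -/

/-- **The polynomial core** (`u = v + 2`; `C, D, Q, V` stand for `C(N, m)` and the three weighted sums): from the two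
row identities and the geometric bound, `2(m+v+5)(2m+v+4)·C ≤ (v+5)(2m+v+4)(D + Q) + (v+5)(v+4)·V`. -/
lemma cellThree_core (v m C D Q V : ℚ) (hm : 0 ≤ m) (hv : 0 ≤ v) (hC : 0 < C) (hD : 0 ≤ D)
    (hid1 : (v + 2 + 1) * Q + 2 * D = (m + (v + 2) + 1) * C)
    (hid2 : 2 * (v + 2 + 1) * V + ((v + 2) ^ 2 - (v + 2) + 2 * m + 2) * D = (m + 2) * (m + (v + 2) + 1) * C)
    (hG : D * ((v + 2 + 1) * (v + 2 + 2) + 2 * m) ≤ m * (m + (v + 2) + 1) * C) :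
    2 * (m + v + 5) * (2 * m + v + 4) * C ≤ (v + 5) * (2 * m + v + 4) * (D + Q) + (v + 5) * (v + 4) * V := by
  have hkey : 2 * (v + 3) * ((v + 5) * (2 * m + v + 4) * (D + Q) + (v + 5) * (v + 4) * V
        - 2 * (m + v + 5) * (2 * m + v + 4) * C)
      = (v ^ 3 * m + v ^ 2 * m ^ 2 + 8 * v ^ 2 * m + 5 * v * m ^ 2 + 23 * v * m + 16 * m ^ 2 + 32 * m) * C
        + (v + 5) * (-v ^ 3 - 5 * v ^ 2 + 2 * v * m - 6 * v - 4 * m - 8) * D := by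
    linear_combination (2 * (v + 5) * (2 * m + v + 4)) * hid1 + ((v + 5) * (v + 4)) * hid2
  have hAC : 0 ≤ (v ^ 3 * m + v ^ 2 * m ^ 2 + 8 * v ^ 2 * m + 5 * v * m ^ 2 + 23 * v * m + 16 * m ^ 2 + 32 * m) * C := by
    positivity
  have hpos : 0 ≤ (v ^ 3 * m + v ^ 2 * m ^ 2 + 8 * v ^ 2 * m + 5 * v * m ^ 2 + 23 * v * m + 16 * m ^ 2 + 32 * m) * C
      + (v + 5) * (-v ^ 3 - 5 * v ^ 2 + 2 * v * m - 6 * v - 4 * m - 8) * D := by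
    rcases le_or_gt 0 (-v ^ 3 - 5 * v ^ 2 + 2 * v * m - 6 * v - 4 * m - 8) with hK | hK
    · exact add_nonneg hAC (mul_nonneg (mul_nonneg (by positivity) hK) hD)
    · -- `K < 0`: the geometric bound `D·L ≤ m(m+v+3)·C` turns the claim into `E·C ≥ 0`
      have hL : 0 < (v + 2 + 1) * (v + 2 + 2) + 2 * m := by positivity
      have hKneg : (v + 5) * (-v ^ 3 - 5 * v ^ 2 + 2 * v * m - 6 * v - 4 * m - 8) ≤ 0 :=
        mul_nonpos_of_nonneg_of_nonpos (by positivity) hK.le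
      have hDL := mul_le_mul_of_nonpos_left hG hKneg
      have hE : 0 ≤ (2 * v ^ 4 * m + 6 * v ^ 3 * m ^ 2 + 4 * v ^ 2 * m ^ 3 + 30 * v ^ 3 * m + 60 * v ^ 2 * m ^ 2
          + 16 * v * m ^ 3 + 158 * v ^ 2 * m + 178 * v * m ^ 2 + 12 * m ^ 3 + 346 * v * m + 156 * m ^ 2 + 264 * m) * C := by
        positivity
      have hident : ((v + 2 + 1) * (v + 2 + 2) + 2 * m)
            * ((v ^ 3 * m + v ^ 2 * m ^ 2 + 8 * v ^ 2 * m + 5 * v * m ^ 2 + 23 * v * m + 16 * m ^ 2 + 32 * m) * C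
              + (v + 5) * (-v ^ 3 - 5 * v ^ 2 + 2 * v * m - 6 * v - 4 * m - 8) * D)
          = (2 * v ^ 4 * m + 6 * v ^ 3 * m ^ 2 + 4 * v ^ 2 * m ^ 3 + 30 * v ^ 3 * m + 60 * v ^ 2 * m ^ 2
              + 16 * v * m ^ 3 + 158 * v ^ 2 * m + 178 * v * m ^ 2 + 12 * m ^ 3 + 346 * v * m + 156 * m ^ 2 + 264 * m) * C
            + ((v + 5) * (-v ^ 3 - 5 * v ^ 2 + 2 * v * m - 6 * v - 4 * m - 8) * (D * ((v + 2 + 1) * (v + 2 + 2) + 2 * m))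
              - (v + 5) * (-v ^ 3 - 5 * v ^ 2 + 2 * v * m - 6 * v - 4 * m - 8) * (m * (m + (v + 2) + 1) * C)) := by
        ring
      have hprod : 0 ≤ ((v + 2 + 1) * (v + 2 + 2) + 2 * m)
            * ((v ^ 3 * m + v ^ 2 * m ^ 2 + 8 * v ^ 2 * m + 5 * v * m ^ 2 + 23 * v * m + 16 * m ^ 2 + 32 * m) * C
              + (v + 5) * (-v ^ 3 - 5 * v ^ 2 + 2 * v * m - 6 * v - 4 * m - 8) * D) := by
        rw [hident]
        linarith [hDL, hE]
      exact nonneg_of_mul_nonneg_right hprod hL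
  have h2 : 0 ≤ 2 * (v + 3) * ((v + 5) * (2 * m + v + 4) * (D + Q) + (v + 5) * (v + 4) * V
      - 2 * (m + v + 5) * (2 * m + v + 4) * C) := by
    rw [hkey]; exact hpos
  have h3 := nonneg_of_mul_nonneg_right h2 (by positivity)
  exact sub_nonneg.1 h3

/-- **Clearing the denominators**: the core inequality gives `Φ(q+3, q) ≤ R̂(q, 3, m)` in its fractional form. -/
lemma cellThree_of_core (v m C D Q V : ℚ) (hm : 0 ≤ m) (hv : 0 ≤ v) (hC : 0 < C)
    (hmain : 2 * (m + v + 5) * (2 * m + v + 4) * C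
      ≤ (v + 5) * (2 * m + v + 4) * (D + Q) + (v + 5) * (v + 4) * V) :
    2 * (m + v + 2 + 3) / (m + v + 2 + 1)
      ≤ (v + 5) * ((D + Q) / ((m + v + 2 + 1) * C))
        + (v + 5) * (v + 4) / 2 * (2 * V / ((m + v + 2 + 1) * (m + v + 2 + m + 2) * C)) := by
  have hY : 0 < (m + v + 2 + 1) * C := by positivity
  have hZ : 0 < (m + v + 2 + 1) * (m + v + 2 + m + 2) * C := by positivity
  rw [← mul_div_assoc, ← mul_div_assoc, div_add_div _ _ hY.ne' hZ.ne',
    div_le_div_iff₀ (by positivity) (mul_pos hY hZ)]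
  have hfac := mul_nonneg (mul_nonneg (sq_nonneg (m + v + 2 + 1)) hC.le) (sub_nonneg.2 hmain)
  have hident : ((v + 5) * (D + Q) * ((m + v + 2 + 1) * (m + v + 2 + m + 2) * C)
        + (m + v + 2 + 1) * C * ((v + 5) * (v + 4) / 2 * (2 * V))) * (m + v + 2 + 1)
      - 2 * (m + v + 2 + 3) * ((m + v + 2 + 1) * C * ((m + v + 2 + 1) * (m + v + 2 + m + 2) * C))
      = (m + v + 2 + 1) ^ 2 * C * ((v + 5) * (2 * m + v + 4) * (D + Q) + (v + 5) * (v + 4) * V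
          - 2 * (m + v + 5) * (2 * m + v + 4) * C) := by
    ring
  linarith [hfac, hident]

/-- **(R̂) on the cell `(q+3, q)` for `u = q − m ≥ 2`** (`q = m + v + 2`): `Φ(q+3, q) ≤ R̂(q, 3, m)`. -/
theorem rhatCell_three_of (m v : ℕ) : phiK (m + v + 2 + 3) (m + v + 2) ≤ rhat (m + v + 2) 3 m := by
  rw [phiK_three, rhat_three_eq, sliceOne_eq_row, sliceTwo_eq_row,
    show m + v + 2 + 1 + m = 2 * m + (v + 2) + 1 by ring]
  have hid1 := row_id_one m (v + 2)
  have hid2 := row_id_two m (v + 2)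
  have hD := row_D_le m (v + 2)
  push_cast at hid1 hid2 hD ⊢
  set C := ((2 * m + (v + 2) + 1).choose m : ℚ) with hCdef
  set Q := ∑ i ∈ range (m + 1), ((2 * m + (v + 2) + 1).choose i : ℚ) with hQdef
  set D := ∑ i ∈ range (m + 1), ((m : ℚ) - i) * ((2 * m + (v + 2) + 1).choose i : ℚ) with hDdef
  set V := ∑ i ∈ range (m + 1), ((m : ℚ) + 1 - i) ^ 2 * ((2 * m + (v + 2) + 1).choose i : ℚ) with hVdef
  have hW : ∑ i ∈ range (m + 1), ((m : ℚ) + 1 - i) * ((2 * m + (v + 2) + 1).choose i : ℚ) = D + Q := by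
    rw [hDdef, hQdef, ← Finset.sum_add_distrib]
    exact Finset.sum_congr rfl (fun i _ => by ring)
  rw [hW]
  have hCpos : (0 : ℚ) < C := by rw [hCdef]; exact_mod_cast Nat.choose_pos (by omega)
  have hDnn : (0 : ℚ) ≤ D := by
    rw [hDdef]
    refine Finset.sum_nonneg (fun i hi => ?_)
    rw [Finset.mem_range] at hi
    have hi' : (i : ℚ) ≤ m := by exact_mod_cast (by omega : i ≤ m)
    have : (0 : ℚ) ≤ (m : ℚ) - i := by linarith
    positivity
  exact cellThree_of_core v m C D Q V (by positivity) (by positivity) hCpos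
    (cellThree_core v m C D Q V (by positivity) (by positivity) hCpos hDnn hid1 hid2 hD)

/-! ### §3 The cell `(q+3, q)` -/

/-- **(R̂) on the whole cell `(q+3, q)`**: `RhatCell q 3` for every `q ≥ 1`. -/
theorem rhatCell_three (q : ℕ) (hq : 1 ≤ q) : RhatCell q 3 := by
  intro m hm
  rcases Nat.eq_or_lt_of_le hm with rfl | hlt
  · exact rhatCell_self m 3 (by norm_num)
  rcases Nat.eq_or_lt_of_le (Nat.succ_le_of_lt hlt) with h | h
  · have := rhatCell_pred q 3 hq (by norm_num)
    rw [show q - 1 = m by omega] at this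
    exact this
  · obtain ⟨v, rfl⟩ : ∃ v, q = m + v + 2 := ⟨q - m - 2, by omega⟩
    exact rhatCell_three_of m v

variable {α : Type} (M : Matroid α) [M.Finite]

/-- **Rule Q pays `Φ(q+3, q)` to EVERY member of the cell `(q+3, q)`** of every finite matroid at the tight layer
`#E = (q+3) + q`, for every `q ≥ 1`. -/
theorem ruleQUp_three (q : ℕ) (hq : 1 ≤ q) (hE : M.E.ncard = (q + 3) + q) : RuleQUp M (q + 3) q :=
  ruleQUp_of_ncard_eq_of_rhatCell M (rhatCell_three q hq) hE

/-- **The UP-Hall form of C-044 on the whole cell `(q+3, q)`** at the tight layer of every finite matroid, every `q ≥ 1`. -/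
theorem hallUp_three (q : ℕ) (hq : 1 ≤ q) (hE : M.E.ncard = (q + 3) + q) (𝒜 : Set (Set α))
    (h𝒜 : 𝒜 ⊆ cellMembers M (q + 3) q) :
    phiK (q + 3) q * (𝒜.ncard : ℚ) ≤ ((upNbhd M (q + 3) q 𝒜).ncard : ℚ) :=
  hallUp_of_ncard_eq_of_rhatCell M (rhatCell_three q hq) hE 𝒜 h𝒜

end PercRepro
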